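/-
Origin: HOME/pub-hodgecm-prl1/lean/Prl1/ThetaModel.lean — session planner-pub-hodgecm-prl1-0 (unit pub-hodgecm-prl1,
expansion prover a-1: CONSTRUCT the realisation).  Intended final place: `HodgeCM/Automorphic/ThetaModel.lean`
(imports `HodgeCM.StubTree.PerLProof`).  Nothing here is asserted: this file is DATA ONLY (a structure of automorphic
primitives, exactly as `HodgeCM.Geometry.Universe` is a structure of geometric primitives); every property of the data is
a named `Prop` in `HodgeCM.Automorphic.ThetaFacts` (final place `HodgeCM/Automorphic/ThetaFacts.lean`).
Origin: expansion seat `planner-pub-hodgecm-prl1-0` (unit pub-hodgecm-prl1), handover v1 2026-08-18T03:12:21Z (`HOME/pub-hodgecm-prl1/lean/Prl1/ThetaModel.lean`, md5 fc412314);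
landed by the gen-5 packager as `HodgeCM/Automorphic/ThetaModel.lean` (module renamed `Prl1.ThetaModel` → `HodgeCM.Automorphic.ThetaModel`, `import Prl1.*` lines renamed accordingly; body otherwise verbatim).
-/
import Summits.HodgeConjecture.HodgeCM.StubTree.PerLProof

set_option autoImplicit false

/-!
# The theta model: automorphic primitives behind PerL v5 §§3–4

`HodgeCM.Universe.ThetaRealisation ι₁ V K Ψ σ` (file `HodgeCM.Automorphic.Realisation`) records the objects and
identities that the last step of PerL Thm 4.4 consumes, and `Universe.RealisationExistsPerL/Face`
(`HodgeCM.StubTree.Inputs`) ask for its EXISTENCE as one existential package.  This file opens that package one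
level: it names the automorphic PRIMITIVES from which PerL v5 §3 builds the realisation —

* per surface datum `(L, ι₁, (V₃,h))`: the Hilbert space `HG = L²([G_U])`, `G_U = U(V₃,h)` (PerL §1.2, tex
  ll. 66–75), the Matsushima embedding `emb Γ : H²(P_Γ, ℂ) → L²([G_U])` of PerL §3.1 (eq. (Qaut), tex ll. 238–257;
  Matsushima–Murakami, Borel–Wallach VII: classes of `P_Γ = Γ\𝔹²` ↦ `(∧²τ)⁻¹`-equivariant scalar automorphic
  functions), and the level-change morphisms `P_{Γ'} → P_Γ`;
* per surface field `(L, ι₁)` and one-form field `K →+* L`: the SIGN RECIPE of Lemma 3.3(a) (tex ll. 280–284: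
  "`s_b(W_i) = m⁻¹(m_b(Ψ_i))` for `b ≠ ι₁` and `s_{ι₁}(W_i) = ε_hol`", in the notation of [Y1neg] v2 Lemmas 3.1,
  3.2), abstracted as two functions: `kappa` — the embedding of `K` whose membership in `Ψ_i` decides the sign at
  the complex embedding `τ` of `L` (PerL (eq:Psit), tex ll. 61–64: `ρ ∈ Ψ_t = φ^h Φ̃_t⁻¹ ⟺ (ρ⁻¹φ^h)|_K ∈ Φ_t`; this
  uses the Galois structure of `L`, which is why it is model data and not `τ ∘ j`), and `frameSign` — the bijection
  `m` / the holomorphy sign `ε_hol`, as one Boolean per embedding;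
* per SEESAW CONTEXT `c = (K, Ψ, σ, D)` at the surface (Def 3.2, tex ll. 269–279, 299–338: the CM field `K` of the
  four types `Ψ`, the eigen-embedding `σ`, and the four hermitian lines `W_i = (L, a_i x ȳ)` with
  `W₁ ⊕ W₂ ≅ W₃ ⊕ W₄` = `HodgeCM.StubTree.SeesawDatum`): the prior programme's frozen analytic packages of §3.3 —
  the torus-free core on `H = L²([U(W)])` (`Perl34.IsolationCore`: AX9, AX1b, the theta kernels `𝒯_Φ`) and the two
  torus sides `(T, w, S₁₂)`, `(T', w', S₃₄)` (`Perl34.TorusData`) — and the THETA ONE-FORMS `Theta c i Γ ⊂ H¹(P_Γ, ℂ)`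
  of type `Ψ_i` (the holomorphic one-forms `u_f` attached to the theta lifts `θ_φ(χ')` of the allowed pairs
  `(W_i, μ_i, χ')`, PerL §3.2 ll. 258–268 and Prop 4.3's proof ll. 643–660).

The model is free in how it realises these (e.g. `Theta c i Γ = ∅` whenever the context is not one PerL's
dictionary covers); what it must satisfy is the input record `ThetaModel.Inputs` (2 print facts, 2 design constraints, 6 PerL open inputs; named `ThetaModel.Axioms` until run 17) of `HodgeCM.Automorphic.ThetaFacts`, each field
a separately citable statement.  From a model, its axioms, the Hodge–Riemann fact `Fact_hodgeRiemann20`, the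
directedness of levels and the Landherr target `HodgeCM.Lemma33bLandherr`, the file `HodgeCM.Proofs.RealisationConstruction`
CONSTRUCTS `U.ThetaRealisation ι₁ V K Ψ σ` and proves `U.RealisationExistsPerL ∧ U.RealisationExistsFace`.
-/

noncomputable section

open scoped TensorProduct InnerProductSpace

namespace HodgeCM

open Literature.AlgebraicGeometry.Motives (CMType)
open Literature.AlgebraicGeometry.ShimuraVarieties (conjRingHomK)
open HodgeCM.Prior.Perl34File

/-- **A seesaw context** at a surface over the CM field `L` (PerL v5 Def 3.2, tex ll. 269–279 and 299–338):
the CM field `K` of the four types (`K ⊂ L`; `K = L` for rfwf's faces), the types `Ψ₀,…,Ψ₃`, the eigen-embedding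
`σ` of the one-forms (PerL: `φ₁`; rfwf: `ι₁`), and the seesaw datum `D` = the four hermitian lines
`W_i = (L, a_i x ȳ)` with `W₁ ⊕ W₂ ≅ W₃ ⊕ W₄` (`StubTree.SeesawDatum`). -/
structure SeesawCtx (L : CMField) where
  /-- the CM field of the types -/
  K : CMField
  /-- the four CM types -/
  Ψ : Fin 4 → CMType K
  /-- the eigen-embedding -/
  σ : K →+* ℂ
  /-- Def 3.2's four lines and the isometry `W₁ ⊕ W₂ ≅ W₃ ⊕ W₄` -/
  D : StubTree.SeesawDatum L

namespace Universe

variable (U : Universe)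

/-- **The theta model**: automorphic PRIMITIVES (types and operations only; all properties are the named
propositions of `ThetaModel.Inputs`).  See the module docstring for the dictionary with PerL v5 §§3–4. -/
structure ThetaModel where
  /-- `L²([G_U])`, `G_U = U(V₃,h)`, `[G_U] = G_U(L₀)\G_U(𝔸_{L₀})` (PerL §1.2) -/
  HG : ∀ (L : CMField) (ι₁ : L →+* ℂ), HermSpace3 L ι₁ → Type
  [instHG₁ : ∀ L ι₁ V, NormedAddCommGroup (HG L ι₁ V)]
  [instHG₂ : ∀ L ι₁ V, InnerProductSpace ℂ (HG L ι₁ V)]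
  [instHG₃ : ∀ L ι₁ V, CompleteSpace (HG L ι₁ V)]
  /-- PerL §3.1 (eq. (Qaut), Matsushima / Borel–Wallach VII): degree-two classes of `P_Γ` as `L²` functions on
  `[G_U]` (zero on the part of `H²` not represented by square-integrable harmonic forms, if any) -/
  emb : ∀ {L : CMField} {ι₁ : L →+* ℂ} {V : HermSpace3 L ι₁} (Γ : Level V),
    U.CohC (U.pms L ι₁ V Γ) 2 →ₗ[ℂ] HG L ι₁ V
  /-- the covering `P_{Γ'} → P_Γ` for `Γ' ≤ Γ` -/
  cover : ∀ {L : CMField} {ι₁ : L →+* ℂ} {V : HermSpace3 L ι₁} (Γ Γ' : Level V),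
    Γ'.Γ ≤ Γ.Γ → U.Mor (U.pms L ι₁ V Γ') (U.pms L ι₁ V Γ)
  /-- sign recipe, first half (PerL (eq:Psit) + Lemma 3.3(a)): the embedding `κ(τ)` of `K` such that the sign of
  the line of type `Ψ` at the complex embedding `τ` of `L` is read off `κ(τ) ∈ Ψ`; arguments `K L j ι₁ τ` -/
  kappa : ∀ (K L : CMField), (K →+* L) → (L →+* ℂ) → (L →+* ℂ) → (K →+* ℂ)
  /-- sign recipe, second half ([Y1neg] v2 Lemmas 3.1/3.2: the bijection `m`, and `ε_hol` at `ι₁`), one Boolean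
  per complex embedding; arguments `L ι₁ τ` -/
  frameSign : ∀ (L : CMField), (L →+* ℂ) → (L →+* ℂ) → Bool
  /-- `L²([U(W)])` for the plane `W = W₁ ⊕ W₂` of the context -/
  H : ∀ {L : CMField} {ι₁ : L →+* ℂ}, HermSpace3 L ι₁ → SeesawCtx L → Type
  /-- `C([G_U])` with the sup norm -/
  CG : ∀ {L : CMField} {ι₁ : L →+* ℂ}, HermSpace3 L ι₁ → SeesawCtx L → Type
  /-- `U(W)(𝔸)` -/
  G : ∀ {L : CMField} {ι₁ : L →+* ℂ}, HermSpace3 L ι₁ → SeesawCtx L → Type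
  /-- the `κ`-typed Schwartz space `𝒮^κ` (PerL ll. 340–345) -/
  SK : ∀ {L : CMField} {ι₁ : L →+* ℂ}, HermSpace3 L ι₁ → SeesawCtx L → Type
  /-- index types of the isotypic decompositions of `L²([U(W)])`, `L²([G_U])` -/
  SigIdx : ∀ {L : CMField} {ι₁ : L →+* ℂ}, HermSpace3 L ι₁ → SeesawCtx L → Type
  SigIdxG : ∀ {L : CMField} {ι₁ : L →+* ℂ}, HermSpace3 L ι₁ → SeesawCtx L → Type
  [instH₁ : ∀ {L : CMField} {ι₁ : L →+* ℂ} (V : HermSpace3 L ι₁) (c : SeesawCtx L), NormedAddCommGroup (H V c)]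
  [instH₂ : ∀ {L : CMField} {ι₁ : L →+* ℂ} (V : HermSpace3 L ι₁) (c : SeesawCtx L), InnerProductSpace ℂ (H V c)]
  [instH₃ : ∀ {L : CMField} {ι₁ : L →+* ℂ} (V : HermSpace3 L ι₁) (c : SeesawCtx L), CompleteSpace (H V c)]
  [instCG₁ : ∀ {L : CMField} {ι₁ : L →+* ℂ} (V : HermSpace3 L ι₁) (c : SeesawCtx L), NormedAddCommGroup (CG V c)]
  [instCG₂ : ∀ {L : CMField} {ι₁ : L →+* ℂ} (V : HermSpace3 L ι₁) (c : SeesawCtx L), NormedSpace ℂ (CG V c)]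
  [instG₁ : ∀ {L : CMField} {ι₁ : L →+* ℂ} (V : HermSpace3 L ι₁) (c : SeesawCtx L), Group (G V c)]
  [instG₂ : ∀ {L : CMField} {ι₁ : L →+* ℂ} (V : HermSpace3 L ι₁) (c : SeesawCtx L), TopologicalSpace (G V c)]
  [instSK : ∀ {L : CMField} {ι₁ : L →+* ℂ} (V : HermSpace3 L ι₁) (c : SeesawCtx L), TopologicalSpace (SK V c)]
  /-- PerL §3.3, the torus-free core (prior programme, frozen): AX9, AX1b, the theta kernels `𝒯_Φ` -/
  core : ∀ {L : CMField} {ι₁ : L →+* ℂ} (V : HermSpace3 L ι₁) (c : SeesawCtx L),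
    Perl34.IsolationCore (H V c) (HG L ι₁ V) (CG V c) (G V c) (SK V c) (SigIdx V c) (SigIdxG V c)
  /-- the (12) torus side `(T = U(W₁) × U(W₂), w, S₁₂)` (PerL ll. 345–349, 387–400) -/
  t12 : ∀ {L : CMField} {ι₁ : L →+* ℂ} (V : HermSpace3 L ι₁) (c : SeesawCtx L), Perl34.TorusData (core V c)
  /-- the (34) torus side `(T' = g(U(W₃) × U(W₄))g⁻¹, w', S₃₄)` (PerL ll. 349, 402, 441) -/
  t34 : ∀ {L : CMField} {ι₁ : L →+* ℂ} (V : HermSpace3 L ι₁) (c : SeesawCtx L), Perl34.TorusData (core V c)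
  /-- the theta one-forms of type `Ψ_i` at level `Γ` (PerL §3.2; Prop 4.3's `u_f`, tex ll. 643–660) -/
  Theta : ∀ {L : CMField} {ι₁ : L →+* ℂ} (V : HermSpace3 L ι₁), SeesawCtx L → Fin 4 → ∀ Γ : Level V,
    Set (U.CohC (U.pms L ι₁ V Γ) 1)

attribute [instance] ThetaModel.instHG₁ ThetaModel.instHG₂ ThetaModel.instHG₃ ThetaModel.instH₁
  ThetaModel.instH₂ ThetaModel.instH₃ ThetaModel.instCG₁ ThetaModel.instCG₂ ThetaModel.instG₁ ThetaModel.instG₂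
  ThetaModel.instSK

namespace ThetaModel

variable {U}
variable (T : U.ThetaModel)

/-- **The required sign** (`true` = positive) of the line of type `Ψ` at the complex embedding `τ` of `L`, for
one-forms of `K →+* L` read at `ι₁` (PerL Lemma 3.3(a), tex ll. 280–284): the frame sign at `τ` if
`κ(τ) ∈ Ψ` (`HodgeCM.ind Ψ (κ τ) = 1`), its negation otherwise. -/
def reqPos (K L : CMField) (j : K →+* L) (ι₁ : L →+* ℂ) (Ψ : CMType K) (τ : L →+* ℂ) : Bool :=
  if ind Ψ (T.kappa K L j ι₁ τ) = 1 then T.frameSign L ι₁ τ else !(T.frameSign L ι₁ τ)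

/-- **Forced signs** (PerL Def 3.2 "with the forced signs", tex ll. 299–304): the four lines `a_i` of the
seesaw datum `D` have, at every complex embedding, the signs required by the types `Ψ_i`. -/
def SignsForced (K L : CMField) (j : K →+* L) (ι₁ : L →+* ℂ) (Ψ : Fin 4 → CMType K)
    (D : StubTree.SeesawDatum L) : Prop :=
  ∀ (i : Fin 4) (τ : L →+* ℂ), (0 < (τ (D.a i)).re ↔ T.reqPos K L j ι₁ (Ψ i) τ = true)

/-- **PerL's hypotheses on a seesaw context** at `(L, ι₁)` under which §§3–4 apply (tex ll. 42–64, 269–284,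
rem:tetra ll. 210–213): the types satisfy the pair-sum identity and are pairwise distinct, `σ` lies in all four
types (PerL: `t_1 = +`; rfwf: `ι₁ ∈ ψ_i`, `HodgeCM.admissible_mem_psi`), `σ` is the restriction of `ι₁` along
some `j : K →+* L`, and the lines of `D` carry the forced signs for that `j`. -/
structure GoodCtx {L : CMField} (ι₁ : L →+* ℂ) (c : SeesawCtx L) : Prop where
  pairSum : PairSum c.Ψ
  injective : Function.Injective c.Ψ
  mem : ∀ i, c.σ ∈ (c.Ψ i).1
  forced : ∃ j : c.K →+* L, ι₁.comp j = c.σ ∧ T.SignsForced c.K L j ι₁ c.Ψ c.D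

/-- The wedge `ω ∧ ω'` of two degree-one classes of `P_Γ` as an `L²` function on `[G_U]`:
`emb Γ (ω ∪ ω')` (PerL §3.1 + Prop 4.3's `u₁ ∧ u₂`, tex ll. 639–642). -/
def Λ {L : CMField} {ι₁ : L →+* ℂ} {V : HermSpace3 L ι₁} (Γ : Level V) :
    U.CohC (U.pms L ι₁ V Γ) 1 →ₗ[ℂ] U.CohC (U.pms L ι₁ V Γ) 1 →ₗ[ℂ] T.HG L ι₁ V :=
  (U.cup2C (U.pms L ι₁ V Γ) 1).compr₂ (T.emb Γ : U.CohC (U.pms L ι₁ V Γ) (1 + 1) →ₗ[ℂ] T.HG L ι₁ V)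

/-- (Ported verbatim from the HodgeCMPerL package; no docstring in the source.) -/
theorem Λ_apply {L : CMField} {ι₁ : L →+* ℂ} {V : HermSpace3 L ι₁} (Γ : Level V)
    (ω ω' : U.CohC (U.pms L ι₁ V Γ) 1) :
    T.Λ Γ ω ω' = T.emb Γ (U.cup2C (U.pms L ι₁ V Γ) 1 ω ω') := rfl

/-- The set of ALL wedge-functions of theta one-forms of types `(Ψ_k, Ψ_l)` over all levels (the generating set
of PerL Lemma 3.5, tex ll. 350–353). -/
def wedgeSet {L : CMField} {ι₁ : L →+* ℂ} (V : HermSpace3 L ι₁) (c : SeesawCtx L) (k l : Fin 4) :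
    Set (T.HG L ι₁ V) :=
  {x | ∃ Γ : Level V, ∃ ω ∈ T.Theta V c k Γ, ∃ ω' ∈ T.Theta V c l Γ, x = T.Λ Γ ω ω'}

end ThetaModel

end Universe

end HodgeCM

end
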